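import Literature.AnabelianGeometry.EtaleTheta.Setting
import Literature.NumberTheory.EllipticCurves.PAdicHeights
import HarnessLib

/-!
# [AbsTopIII] Cor. 1.10 (iii) WITH ITS PRINTED FUNCTORIALITY, Galois side, tempered version — the retype
# of FACT-LIST rows F-0396 `Cor_1_10_iii` / F-0348 `Cor_1_10_ii_c` to printed strength (abc-iut C-R25 / C-R46 (a),
# human-approved OPTION A «FACT-LIST RETYPE», 21-frontier 2026-08-26 17:35:20Z; D-0067 exception)

S. Mochizuki, *Topics in Absolute Anabelian Geometry III: Global Reconstruction Algorithms*, §1, author's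
manuscript (kurims render url-5493eb38cbb7; all locators below are to that render):

* Cor. 1.10 p. 41 l. 28–38: «(Reconstruction of the Function Field for MLF's) Let `X` be a hyperbolic
  orbicurve over an MLF `k` […] `1 → Δ_X → Π_X → G_k → 1` […] the resulting extension of profinite groups.»
* Cor. 1.10 (iii) p. 43 l. 27–30: «Suppose further that `X` is of strictly Belyi type [so that we are in the
  situation of Theorem 1.9]. Then there exists a functorial "group-theoretic" algorithm for reconstructing the
  function field `K_X` of `X` from the profinite group `Π_X` [cf. Remark 1.9.2], as follows:» — (e)–(h); (h)
  p. 44 l. 8–24: «One constructs the additive structure on […] `k^× ∪ {0}` as the unique continuous extension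
  of the additive structure on `(k^× ∩ k̄_NF^×) ∪ {0}` constructed in Theorem 1.9, (e) […] compatible […]
  with the additive structures on the various `(k′)^× ∪ {0}`, for `k′ ⊆ k̄` a finite extension of `k`»;
  p. 44 l. 33–34: «Here, the asserted "functoriality" is with respect to arbitrary open injective
  homomorphisms of profinite groups [i.e., of "`Π_X`"] — cf. Remark 1.10.1 below.»
* Rmk. 1.9.2 p. 38 l. 30–34: «When `k` is an MLF or NF […] the "extension of profinite groups
  `1 → Δ_X → Π_X → G_k → 1`" […] may be replaced by the single profinite group `Π_X` [cf. [Mzk20], Theorem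
  2.6, (v), (vi)]. A similar remark applies in the tempered case discussed in Remark 1.9.1.»
* Rmk. 1.10.2 p. 45 l. 2–3: «Just as was the case with Theorem 1.9, one may give a tempered version of
  Corollary 1.10 — cf. Remark 1.9.1» (Rmk. 1.9.1 p. 38 l. 25–29: «the profinite étale fundamental group `Π_X`
  is replaced by the tempered fundamental group of `X` [and the expression "profinite group" is replaced by
  "topological group"]»).
* Def. 1.7 (i) p. 35 l. 47–52: «We shall say that `X` is an NF-curve if `X_k̄ := X ×_k k̄` is defined over
  `k̄_NF`»; [AbsTopII] Def. 3.5 p. 71 l. 6–8 (kurims url-585b8d0ad0d9): «We shall say that `X` is of strictly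
  Belyi type if it is defined over a number field and isogenous [cf. §0] to a hyperbolic curve of genus
  zero»; [AbsTopIII] Rmk. 2.8.3 p. 64 l. 26–27: «any elliptically admissible hyperbolic orbicurve defined over
  a number field is of strictly Belyi type».

## What is typed, and why in this shape

THE GALOIS SIDE OF THE FUNCTORIALITY OF Cor. 1.10 (iii) (tempered version).  Read the functorial algorithm
`Π ↦ (k̄(Π) ⊇ k(Π), K_X(Π))` of (iii)(h) on a topological AUTOMORPHISM `α` of `Π = Π^tp_X`: `α` transports the
reconstructed topological field `k̄(Π) = ⋃_{k′} (k′)^× ∪ {0}` (on which `Π` acts through `Π ↠ G_k`) to itself,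
`Π`-semilinearly along `α`; comparing with the tautological `G_k`-equivariant identification of `k̄(Π)` with
`k̄ = ℚ̄_p` (the Kummer map of (d)), `α` induces a CONTINUOUS field automorphism `τ` of `ℚ̄_p` — hence one over
`ℚ_p`, i.e. an element `τ ∈ G_{ℚ_p} = Gal(ℚ̄_p/ℚ_p)` — such that the automorphism of `G_k ≤ G_{ℚ_p}` induced by
`α` is the restriction of `Inn(τ)`:

  (HGAL)  `∀ α ∈ Aut_top(Π^tp_X) ∃ τ ∈ G_{ℚ_p} ∀ x ∈ Π^tp_X, aug(α x) = τ · aug(x) · τ⁻¹`.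

This is the clause of Cor. 1.10 that the abc-iut cone CONSUMES (nodes IUTchII:Prop1.3(iii), IUTchII:Prop3.4(i),
IUTchII:Cor1.11 `Π`-side; binder of record `hgal`/`hHGAL` of
`Literature.IUT.HodgeArakelov.EtaleLevels.nonempty_galCorPiXInput_familyLim_of_hgalois`,
`…EtaleThetaDataOfSetting.hgal_of_hgalois`, GAP-LEDGER D-G-w5d169-3 / D-G-w5d145-2), at the curve `X̲̲_v`
of [EtTh] §2 over `K_v` at a bad place `v` of an initial Θ-datum ([IUTchI] Rmk. 3.1.2 (ii) p. 64: «we shall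
always think of [AbsTopIII], Theorem 1.9 [as well as the other results of [AbsTopIII] that arise as
consequences of [AbsTopIII], Theorem 1.9] as being applied to […] `Π^tp_{X̲̲_v}` via the "Θ-approach"»).
The CYCLOTOMIC clause of the same naturality (Cor. 1.10 (ii)(c) «the natural isomorphism
`μ_Ẑ(G_k) ⥲ μ_Ẑ(Π_X)`», row F-0348; binder (HCYC)) is, at this instance, a KERNEL COROLLARY of (HGAL)
(`Literature.IUT.HodgeArakelov.EtaleThetaDataOfSetting.hcyc_of_hgal`, p450689; D-G-w5d169-3 #5), so no
separate cyclotomic fact is typed here.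

THE FROZEN ROWS UNDER-READ PRINT.  `CurveModel.Cor_1_10_iii` (F-0396, `Reconstruction.lean`) and
`CurveModel.Cor_1_10_ii_c` (F-0348, `CyclotomicSynchronization.lean`) type Cor. 1.10 as bare EXISTENCE
(`∃` algorithm, `Nonempty (≃)`), with no clause tying the reconstructed field isomorphism to a GIVEN `α` and
no junction to the tempered groups of [EtTh]/[SemiAnbd] (limitation recorded in those files and in
GAP-LEDGER G-w4d042-1 / G-w5d145-2).  abc-iut-plan RULING C-R25 (2026-08-26T13:43:05Z) classified (HGAL) as
PRINT'S CITED INPUT [AbsTopIII] Thm. 1.9 / Cor. 1.10 (iii) + (c) read WITH ITS PRINTED NATURALITY at the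
strictly-Belyi instance, and the human chose OPTION A «retype F-0348 / F-0396 to printed strength» (relay
21-frontier 17:35:20Z, director-abc 17:41:51Z, execution order abc-iut-plan C-R46 18:10:29Z; this file =
C-R46 (a), one writer abc-iut-f-052 gen 5).  A retype to print adds no assumption beyond the frozen list's
intent; the frozen declarations are NOT edited (no DEFS-FREEZE event) — this is a NEW file.

THE SUBJECT: the [EtTh] §1 interface `ThetaSetting p` (abc-iut-L2's transcription of [EtTh] §1: a
once-punctured elliptic curve `X_K` with split multiplicative reduction over a finite extension `K ⊆ ℚ̄_p` of
`ℚ_p`, its tempered fundamental group `Π^tp_X` with augmentation `aug : Π^tp_X → G_{ℚ_p}` onto `G_K`, and the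
`q`-parameter `q_X ∈ K` of the underlying elliptic curve `E_K ≅` Tate curve `E_{q_X}`, [EtTh] §1 p. 13) —
the vocabulary in which every consumer binds `hgal`.  The OPEN SUBGROUPS OF FINITE INDEX `H ≤ Π^tp_X` are the
tempered fundamental groups `Π^tp_{X_H}` of the connected finite étale coverings `X_H → X_K` (hyperbolic
curves over finite extensions `K_H` of `K`, `aug(H) = G_{K_H}`); among them `Π^tp_{X̲̲}` (abc-iut-L2's
`EtaleThetaData.DoubleUnderline.Huu`, open of index `l²`).

THE PRINTED HYPOTHESIS «`X` is of strictly Belyi type», rendered INTRINSICALLY on the interface: for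
`X_K = E_K ∖ {O}` a once-punctured elliptic curve and for every connected finite étale covering `X_H` of it,
[AbsTopII] Def. 3.5 reduces to «`E_K ×_K K̄` is defined over `ℚ̄`», i.e. «`j(E_K) ∈ ℚ̄`»: (1) «isogenous to a
hyperbolic curve of genus zero» holds for EVERY once-punctured elliptic curve — `Y := E ∖ E[2] → E ∖ {O} = X`
by `[2]` (finite étale of degree `4`) and `Y → ℙ¹ ∖ {∞, e₁, e₂, e₃}` by the `x`-coordinate (finite étale of
degree `2`), and a finite étale `X_H → X` composes; (2) «defined over a number field» (= NF-curve, Def. 1.7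
(i): `X ×_K K̄` descends to `K̄_NF = ℚ̄`) holds for `X` and all `X_H` iff `E_K ×_K K̄` descends to `ℚ̄` iff
`j(E_K)` is algebraic over `ℚ` (finite étale coverings of `X_ℚ̄` are defined over `ℚ̄`).  With `E_K ≅ E_{q_X}`
(Tate uniformisation, [EtTh] §1 p. 13 / the interface's meaning of `qX`) and `j(E_q) = 1/q + 744 + 196884 q + ⋯`
(the tree's `Literature.NumberTheory.EllipticCurves.tateJ`, Silverman ATAEC Thm. V.3.1 (b)), the hypothesis
is `IsAlgebraic ℚ (tateJ D.qX)`.  At the cone's data (`X_v := (E_F ∖ {O}) ×_F K_v`, `E_F` over the number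
field `F`, [IUTchI] Def. 3.1 (b)) it holds because `j(E_{q_v}) = j(E_F) ∈ F` — the provenance clause (O) of
C-R25 in checkable form ([AbsTopIII] Rmk. 2.8.3 is print's own route: elliptically admissible + defined over
an NF ⟹ strictly Belyi).
-- TODO(general form): [AbsTopIII] Cor. 1.10 (iii) is stated for ARBITRARY hyperbolic orbicurves of strictly
-- Belyi type over an MLF and asserts the reconstruction of `K_X ⊇ k̄` itself, functorially in open injective
-- homomorphisms; typed here is its Galois-side consequence for automorphisms, for the finite étale coverings of
-- a once-punctured elliptic curve carried by a `ThetaSetting` (the tree has no étale/tempered `π₁` of a general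
-- curve, plan/FOUNDATIONS.md row 12).

STATEMENT-ONLY (two `def … : Prop`, no instance / notation / axiom; nothing of [AbsTopIII], [EtTh] or
[IUTchI–III] is asserted).  HONEST FRAMING: a FACT-LIST row is an assumption LABEL on OUR typed statement of a
refereed result ([AbsTopIII], PRIMS 2015), consumed BY NAME at the cone's genuine data; relative to the
INTERFACE `ThetaSetting` (whose fields are data, not the genuine tempered `π₁`) the universal closure over all
`D` is a schema, not a theorem; typed ≠ proved; no side is taken on [IUTchIII] Cor. 3.12; nothing here bears
on the truth of abc.
-/

namespace Literature.AnabelianGeometry.AbsoluteAnabelian.AbsTopIII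

open Literature.AnabelianGeometry.SemiGraphs Literature.AnabelianGeometry.EtaleTheta
open Literature.NumberTheory.EllipticCurves

variable {p : ℕ} [Fact p.Prime]

/-- **(HGAL) for a subgroup `H ≤ Π^tp_X` of the [EtTh] §1 setting** — «every topological automorphism `α` of
`H` lies over an inner automorphism of `G_{ℚ_p}`»: for every `α : H ≃ₜ* H` there is `τ ∈ G_{ℚ_p} = Gal(ℚ̄_p/ℚ_p)`
with `aug(α x) = τ · aug(x) · τ⁻¹` for all `x ∈ H` (`aug : Π^tp_X → G_{ℚ_p}` the augmentation of the setting,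
[SemiAnbd] §6 p. 69).  For `H = Π^tp_{X̲̲}` (`EtaleThetaData.DoubleUnderline.Huu`) this is VERBATIM the binder
`hHGAL : ∀ α : (Pi C) ≃ₜ* (Pi C), ∃ τ : GQp p, ∀ x, aug C (α x) = τ * aug C x * τ⁻¹` of the abc-iut L6 consumers
(`Pi C = TopGroup.mk ↥C.Huu`, `aug C = aug ∘ C.Huu.subtype`).  A PREDICATE (the Galois-side shape of the
functoriality of [AbsTopIII] Cor. 1.10 (iii) on automorphisms); nothing is asserted.
[cite: MochizukiAbsTopIII2015, Cor 1.10 (iii) p.43] -/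
def TemperedAutOverGQp (D : ThetaSetting p) (H : Subgroup D.PiTemp) : Prop :=
  ∀ α : H ≃ₜ* H, ∃ τ : GQp p, ∀ x : H, D.aug ((α x : H) : D.PiTemp) = τ * D.aug (x : D.PiTemp) * τ⁻¹

/-- **[AbsTopIII] Cor. 1.10 (iii) with its printed functoriality (p. 43 l. 27–30, p. 44 l. 33–34), Galois side,
tempered version (Rmks. 1.9.1, 1.9.2, 1.10.2), for the finite étale coverings of the once-punctured elliptic curve
of an [EtTh] §1 setting** — the printed-strength retype of FACT-LIST rows F-0396 `CurveModel.Cor_1_10_iii` and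
(through the kernel corollary `EtaleThetaDataOfSetting.hcyc_of_hgal`) F-0348 `CurveModel.Cor_1_10_ii_c`
(abc-iut C-R25 / C-R46 (a); human-approved OPTION A, D-0067 exception): IF the underlying elliptic curve
`E_K ≅ E_{q_X}` is defined over a number field — `j(q_X) = 1/q_X + 744 + ⋯ ∈ K` algebraic over `ℚ`, so that `X_K`
and all its connected finite étale coverings `X_H` are NF-curves (Def. 1.7 (i)) isogenous to `ℙ¹ ∖ {4 pts}`, i.e.
«of strictly Belyi type» ([AbsTopII] Def. 3.5; [AbsTopIII] Rmk. 2.8.3) — THEN for every open subgroup of finite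
index `H = Π^tp_{X_H} ≤ Π^tp_X` (a hyperbolic curve `X_H` of strictly Belyi type over the MLF `K_H`,
`aug(H) = G_{K_H}`), every topological automorphism of `H` lies over `Inn(τ)|_{G_{K_H}}` for some `τ ∈ G_{ℚ_p}`
((HGAL), `TemperedAutOverGQp D H`): the reconstructed topological field `k̄ ∪ K_{X_H}` of (iii)(h) is
FUNCTORIAL in `Π^tp_{X_H}`, so an automorphism of `Π^tp_{X_H}` induces a continuous automorphism of `K̄ = ℚ̄_p`,
i.e. an element of `G_{ℚ_p}`, compatibly with `Π^tp_{X_H} ↠ G_{K_H} ≤ G_{ℚ_p}`.  NAMED FACT relative to the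
interface `ThetaSetting` (consumed at `H := Π^tp_{X̲̲_v}`, [IUTchI] Rmk. 3.1.2 (ii)); the universal closure
over all `D` is a schema (the interface does not force `Π^tp_X` to be the genuine tempered `π₁`), as for every
interface-relative row of the cell.  «Retypes F-0348 / F-0396 to printed strength (old typing = bare existence,
weaker than print); human-approved D-0067 exception» (abc-iut-plan C-R46 (a)).
-- TODO(general form): arbitrary hyperbolic orbicurves of strictly Belyi type over an MLF; the full output
-- `(k̄ ⊆ K_X·k̄)` with its `Π`-action, functorial in open injective homomorphisms (Rmk. 1.10.1 (i)).
[cite: MochizukiAbsTopIII2015, Cor 1.10 (iii) p.43] -/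
def Cor_1_10_iii_natural (D : ThetaSetting p) : Prop :=
  IsAlgebraic ℚ (tateJ D.qX) →
    ∀ H : Subgroup D.PiTemp, IsOpen (H : Set D.PiTemp) → H.FiniteIndex → TemperedAutOverGQp D H

end Literature.AnabelianGeometry.AbsoluteAnabelian.AbsTopIII
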